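import Literature.NumberTheory.QuadraticForms.LandherrHermitianMatrices
import HarnessLib

/-!
# The positive index of a complex hermitian matrix is a congruence invariant (Sylvester);
# Landherr's theorem in local-at-infinity form
(Sylvester 1852 ∕ Horn–Johnson Thm. 4.5.8; Landherr 1936; Shimura, Doc. Math. 13 (2008) Thm. 2.2 (i); Rogawski (1990) §3.3)

Topic `NumberTheory/QuadraticForms`; namespace `Literature.NumberTheory.QuadraticForms` (§1–§2 inside `Landherr`, joining
★ `LandherrHermitianMatrices`); THEOREMS ONLY (no definition, no instance, no named fact, no `sorry`).
GAP (G-c) «Sylvester at ∞» of F0P5a-p03's `CENSUS-R6R7-CartanObstruction` (G6 rows R6∕R7, T1 engine line, crux H413):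
in the (→) direction of Rogawski's Prop. 3.3.1 the candidate form `H · y` is congruent to `H` over every archimedean
completion, and Landherr's theorem (★ `hermitianMatrices_congruent_iff_invariants`) wants EQUAL POSITIVE INDICES at every
complex embedding `τ : L →+* ℂ`; the bridge is Sylvester's law of inertia in CONGRUENCE form, which the tree had only
relative to an `L`-rational diagonalisation (★ `Landherr.card_pos_eigenvalues_eq_posCount`).

WHAT IS PROVED
* §1 COMPLEX SYLVESTER, congruence form (any finite index type): **`Landherr.card_pos_eigenvalues_le_of_congr`** — if
  `gᴴ A g = B` for hermitian `A, B` (ANY `g`, possibly singular) then `#{i | 0 < λᵢ(B)} ≤ #{i | 0 < λᵢ(A)}`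
  (`Matrix.IsHermitian.eigenvalues`; spectral theorem on both sides + ★ `Landherr.card_pos_le_of_congr`);
  **`Landherr.card_pos_eigenvalues_eq_of_congr`** — equality when `g` is invertible; `…_of_congr_units` (`g : GL ι ℂ`).
* §2 CM READING at an embedding: **`Landherr.card_pos_eigenvalues_map_eq_of_congr`** — for `σ`-hermitian `H, H'` over a CM
  field `L` and `τ : L →+* ℂ`, a complex congruence `gᴴ τ(H) g = τ(H')` (`g ∈ GL(ℂ)`) forces equal positive indices of
  `τ(H)`, `τ(H')` (the Landherr invariant at `τ`); `…_of_congr_rat` — the `L`-rational special case `g := τ(G)`.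
  **`Landherr.forall_card_pos_eigenvalues_map_eq_of_forall_congr`** (`_units`) — the DISCHARGE of R6a's signature clause `hsig :
  ∀ ρ h₁ h₂, #pos h₁ = #pos h₂` from `∀ ρ, ∃ g, IsUnit g.det ∧ gᴴ ρ(H) g = ρ(K)` (any base ring, any hermitian witnesses).
* §3 LANDHERR, LOCAL-AT-∞ FORM: **`hermitianMatrices_congruent_iff_forall_embedding_congruent`** —
  `H' = ᵗ(σg) H g` for some `g ∈ GL(L)` **iff** `τ(H) ≅_ℂ τ(H')` at every complex embedding `τ` AND `det H = det H' · N(z)` for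
  some `z ∈ Lˣ`; one-way readers `forall_embedding_congruent_of_congruent`, `congruent_of_forall_embedding_congruent_of_det`.

## References
* R. A. Horn, C. R. Johnson, *Matrix Analysis*, 2nd ed. (2013), Thm. 4.5.8 (Sylvester's law of inertia) [HornJohnson2013].
* W. Landherr, Abh. Math. Sem. Univ. Hamburg 11 (1936) 245–248 [Landherr1936HermitianForms].
* J. D. Rogawski, *Automorphic Representations of Unitary Groups in Three Variables* (1990), §3.3 [Rogawski1990].
-/

set_option autoImplicit false

noncomputable section

open NumberField
open scoped Matrix ComplexConjugate

namespace Literature.NumberTheory.QuadraticForms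

namespace Landherr

/-! ## §1 Sylvester's law of inertia, congruence form, for complex hermitian matrices -/

section Complex

variable {ι : Type} [Fintype ι] [DecidableEq ι]

/-- Spectral theorem for hermitian matrices, matrix form: `A = U · diag(λ) · Uᴴ` with `U Uᴴ = 1 = Uᴴ U` and `Uᴴ A U = diag(λ)`
(`λ = Matrix.IsHermitian.eigenvalues`, real; Mathlib's `eigenvectorUnitary`). [cite: HornJohnson2013, Thm. 4.1.5] -/
theorem exists_unitary_diagonalisation {A : Matrix ι ι ℂ} (hA : A.IsHermitian) :
    ∃ U : Matrix ι ι ℂ, U * Uᴴ = 1 ∧ Uᴴ * U = 1 ∧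
      Uᴴ * A * U = Matrix.diagonal (RCLike.ofReal ∘ hA.eigenvalues) ∧
        U * Matrix.diagonal (RCLike.ofReal ∘ hA.eigenvalues) * Uᴴ = A := by
  set U : Matrix ι ι ℂ := (hA.eigenvectorUnitary : Matrix ι ι ℂ) with hUdef
  have hU : Uᴴ * A * U = Matrix.diagonal (RCLike.ofReal ∘ hA.eigenvalues) := by
    have h := hA.conjStarAlgAut_star_eigenvectorUnitary
    rw [Unitary.conjStarAlgAut_star_apply, Matrix.star_eq_conjTranspose] at h
    exact h
  have hUU : U * Uᴴ = 1 := by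
    have h := Unitary.coe_mul_star_self hA.eigenvectorUnitary
    rwa [Unitary.coe_star, Matrix.star_eq_conjTranspose] at h
  have hUU' : Uᴴ * U = 1 := by
    have h := Unitary.coe_star_mul_self hA.eigenvectorUnitary
    rwa [Matrix.star_eq_conjTranspose] at h
  refine ⟨U, hUU, hUU', hU, ?_⟩
  rw [← hU]
  calc U * (Uᴴ * A * U) * Uᴴ = (U * Uᴴ) * A * (U * Uᴴ) := by simp only [Matrix.mul_assoc]
    _ = A := by rw [hUU, Matrix.one_mul, Matrix.mul_one]

/-- **Sylvester, congruence form (inequality).**  If `gᴴ · A · g = B` for complex hermitian `A, B` and ANY square `g`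
(possibly singular), then `B` has at most as many positive eigenvalues as `A`. [cite: HornJohnson2013, Thm. 4.5.8] -/
theorem card_pos_eigenvalues_le_of_congr {A B : Matrix ι ι ℂ} (hA : A.IsHermitian) (hB : B.IsHermitian)
    {g : Matrix ι ι ℂ} (h : gᴴ * A * g = B) :
    (Finset.univ.filter fun i => 0 < hB.eigenvalues i).card ≤ (Finset.univ.filter fun i => 0 < hA.eigenvalues i).card := by
  obtain ⟨U, -, -, -, hUA⟩ := exists_unitary_diagonalisation hA
  obtain ⟨V, -, -, hVB, -⟩ := exists_unitary_diagonalisation hB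
  -- `(Uᴴ g V)ᴴ · diag(λ_A) · (Uᴴ g V) = Vᴴ gᴴ (U diag(λ_A) Uᴴ) g V = Vᴴ B V = diag(λ_B)`
  have hc : (Uᴴ * g * V)ᴴ * Matrix.diagonal (RCLike.ofReal ∘ hA.eigenvalues) * (Uᴴ * g * V) =
      Matrix.diagonal (RCLike.ofReal ∘ hB.eigenvalues) := by
    calc (Uᴴ * g * V)ᴴ * Matrix.diagonal (RCLike.ofReal ∘ hA.eigenvalues) * (Uᴴ * g * V)
        = Vᴴ * (gᴴ * (U * Matrix.diagonal (RCLike.ofReal ∘ hA.eigenvalues) * Uᴴ) * g) * V := by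
          rw [Matrix.conjTranspose_mul, Matrix.conjTranspose_mul, Matrix.conjTranspose_conjTranspose]
          simp only [Matrix.mul_assoc]
      _ = Matrix.diagonal (RCLike.ofReal ∘ hB.eigenvalues) := by rw [hUA, h, hVB]
  have hle := card_pos_le_of_congr hc
  rwa [card_pos_re_ofReal, card_pos_re_ofReal] at hle

/-- **Sylvester's law of inertia, congruence form.**  If `gᴴ · A · g = B` for complex hermitian `A, B` and invertible `g`,
then `A` and `B` have the same number of positive eigenvalues. [cite: HornJohnson2013, Thm. 4.5.8] -/
theorem card_pos_eigenvalues_eq_of_congr {A B : Matrix ι ι ℂ} (hA : A.IsHermitian) (hB : B.IsHermitian)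
    {g : Matrix ι ι ℂ} (hg : IsUnit g.det) (h : gᴴ * A * g = B) :
    (Finset.univ.filter fun i => 0 < hA.eigenvalues i).card = (Finset.univ.filter fun i => 0 < hB.eigenvalues i).card := by
  refine le_antisymm ?_ (card_pos_eigenvalues_le_of_congr hA hB h)
  -- the inverse congruence `(g⁻¹)ᴴ · B · g⁻¹ = A`
  have hW : g * g⁻¹ = 1 := Matrix.mul_nonsing_inv g hg
  have hWc : g⁻¹ᴴ * gᴴ = 1 := by rw [← Matrix.conjTranspose_mul, hW, Matrix.conjTranspose_one]
  have h' : g⁻¹ᴴ * B * g⁻¹ = A := by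
    rw [← h]
    calc g⁻¹ᴴ * (gᴴ * A * g) * g⁻¹ = (g⁻¹ᴴ * gᴴ) * A * (g * g⁻¹) := by simp only [Matrix.mul_assoc]
      _ = A := by rw [hWc, hW, Matrix.one_mul, Matrix.mul_one]
  exact card_pos_eigenvalues_le_of_congr hB hA h'

/-- Sylvester's law of inertia, congruence form, for `g ∈ GL(ℂ)`. [cite: HornJohnson2013, Thm. 4.5.8] -/
theorem card_pos_eigenvalues_eq_of_congr_units {A B : Matrix ι ι ℂ} (hA : A.IsHermitian) (hB : B.IsHermitian)
    (g : GL ι ℂ) (h : (g : Matrix ι ι ℂ)ᴴ * A * (g : Matrix ι ι ℂ) = B) :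
    (Finset.univ.filter fun i => 0 < hA.eigenvalues i).card = (Finset.univ.filter fun i => 0 < hB.eigenvalues i).card :=
  card_pos_eigenvalues_eq_of_congr hA hB (Matrix.isUnits_det_units g) h

end Complex

/-! ## §2 The Landherr invariant at a complex embedding is a local congruence invariant -/

section Embedding

variable (L : Type) [Field L] [NumberField L] [IsCMField L] {ι : Type} [Fintype ι] [DecidableEq ι]

/-- **The positive index at `τ` is an invariant of complex congruence.**  For `σ`-hermitian `H, H'` over the CM field `L`
and a complex embedding `τ`, if `gᴴ · τ(H) · g = τ(H')` with `g` invertible over `ℂ`, then `τ(H)` and `τ(H')` have the same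
number of positive eigenvalues. [cite: HornJohnson2013, Thm. 4.5.8] [cite: Landherr1936HermitianForms] -/
theorem card_pos_eigenvalues_map_eq_of_congr {H H' : Matrix ι ι L} (hH : conjTranspose L H = H) (hH' : conjTranspose L H' = H')
    (τ : L →+* ℂ) {g : Matrix ι ι ℂ} (hg : IsUnit g.det) (h : gᴴ * H.map τ * g = H'.map τ) :
    (Finset.univ.filter fun i => 0 < (isHermitian_map L hH τ).eigenvalues i).card =
      (Finset.univ.filter fun i => 0 < (isHermitian_map L hH' τ).eigenvalues i).card :=
  card_pos_eigenvalues_eq_of_congr (isHermitian_map L hH τ) (isHermitian_map L hH' τ) hg h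

/-- The `GL(ℂ)` form of `card_pos_eigenvalues_map_eq_of_congr`. [cite: HornJohnson2013, Thm. 4.5.8] -/
theorem card_pos_eigenvalues_map_eq_of_congr_units {H H' : Matrix ι ι L} (hH : conjTranspose L H = H)
    (hH' : conjTranspose L H' = H') (τ : L →+* ℂ) (g : GL ι ℂ)
    (h : (g : Matrix ι ι ℂ)ᴴ * H.map τ * (g : Matrix ι ι ℂ) = H'.map τ) :
    (Finset.univ.filter fun i => 0 < (isHermitian_map L hH τ).eigenvalues i).card =
      (Finset.univ.filter fun i => 0 < (isHermitian_map L hH' τ).eigenvalues i).card :=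
  card_pos_eigenvalues_map_eq_of_congr L hH hH' τ (Matrix.isUnits_det_units g) h

/-- The `L`-rational special case: a congruence `ᵗ(σG) · H · G = H'` over `L` with `det G ≠ 0` gives equal positive indices at
every complex embedding (`g := τ(G)`, ★ `congr_map_embedding`). [cite: Landherr1936HermitianForms] -/
theorem card_pos_eigenvalues_map_eq_of_congr_rat {H H' G : Matrix ι ι L} (hH : conjTranspose L H = H)
    (hH' : conjTranspose L H' = H') (hG : IsUnit G.det) (e : conjTranspose L G * H * G = H') (τ : L →+* ℂ) :
    (Finset.univ.filter fun i => 0 < (isHermitian_map L hH τ).eigenvalues i).card =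
      (Finset.univ.filter fun i => 0 < (isHermitian_map L hH' τ).eigenvalues i).card :=
  card_pos_eigenvalues_map_eq_of_congr L hH hH' τ (isUnit_det_map_embedding L hG τ) (congr_map_embedding L e τ)

/-- **DISCHARGE OF A SIGNATURE CLAUSE from archimedean congruences**, in the binder shape R6a (`CartanRealisation`) holds it: if at every
complex embedding `ρ` some invertible complex `g` has `gᴴ · ρ(H) · g = ρ(K)`, then for ALL hermitian witnesses `h₁, h₂` the positive indices
of `ρ(H)` and `ρ(K)` agree (any base ring `L`, any `H, K`). [cite: HornJohnson2013, Thm. 4.5.8] -/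
theorem forall_card_pos_eigenvalues_map_eq_of_forall_congr {R : Type} [CommRing R] {H K : Matrix ι ι R}
    (hloc : ∀ ρ : R →+* ℂ, ∃ g : Matrix ι ι ℂ, IsUnit g.det ∧ gᴴ * H.map ρ * g = K.map ρ) :
    ∀ (ρ : R →+* ℂ) (h₁ : (H.map ρ).IsHermitian) (h₂ : (K.map ρ).IsHermitian),
      (Finset.univ.filter fun i => 0 < h₁.eigenvalues i).card = (Finset.univ.filter fun i => 0 < h₂.eigenvalues i).card := by
  intro ρ h₁ h₂
  obtain ⟨g, hg, h⟩ := hloc ρ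
  exact card_pos_eigenvalues_eq_of_congr h₁ h₂ hg h

/-- The `GL(ℂ)`-phrased variant of `forall_card_pos_eigenvalues_map_eq_of_forall_congr`. [cite: HornJohnson2013, Thm. 4.5.8] -/
theorem forall_card_pos_eigenvalues_map_eq_of_forall_congr_units {R : Type} [CommRing R] {H K : Matrix ι ι R}
    (hloc : ∀ ρ : R →+* ℂ, ∃ g : GL ι ℂ, (g : Matrix ι ι ℂ)ᴴ * H.map ρ * (g : Matrix ι ι ℂ) = K.map ρ) :
    ∀ (ρ : R →+* ℂ) (h₁ : (H.map ρ).IsHermitian) (h₂ : (K.map ρ).IsHermitian),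
      (Finset.univ.filter fun i => 0 < h₁.eigenvalues i).card = (Finset.univ.filter fun i => 0 < h₂.eigenvalues i).card := by
  intro ρ h₁ h₂
  obtain ⟨g, h⟩ := hloc ρ
  exact card_pos_eigenvalues_eq_of_congr_units h₁ h₂ g h

end Embedding

end Landherr

/-! ## §3 Landherr's theorem, local-at-infinity form -/

section LocalGlobal

variable (L : Type) [Field L] [NumberField L] [IsCMField L] {ι : Type} [Fintype ι] [DecidableEq ι]

/-- **(→) at infinity**: a congruence over `L` gives a complex congruence `gᴴ · τ(H) · g = τ(H')`, `g ∈ GL(ℂ)`, at every complex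
embedding `τ` (`g := τ(G)`). [cite: Landherr1936HermitianForms] -/
theorem forall_embedding_congruent_of_congruent {H H' : Matrix ι ι L}
    (h : ∃ g : GL ι L, ((g : Matrix ι ι L).transpose.map (IsCMField.complexConj L)) * H * (g : Matrix ι ι L) = H')
    (τ : L →+* ℂ) : ∃ g : GL ι ℂ, (g : Matrix ι ι ℂ)ᴴ * H.map τ * (g : Matrix ι ι ℂ) = H'.map τ := by
  obtain ⟨G, hG⟩ := h
  have hu : IsUnit ((G : Matrix ι ι L).map τ).det :=
    Landherr.isUnit_det_map_embedding L (Matrix.isUnits_det_units G) τ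
  exact ⟨Matrix.nonsingInvUnit _ hu, Landherr.congr_map_embedding L hG τ⟩

/-- **(←)**: complex congruence at every embedding plus the discriminant condition give a congruence over `L`
(Landherr ★ `hermitianMatrices_congruent_iff_invariants` with the positive indices matched by §2).
[cite: Landherr1936HermitianForms] [cite: Rogawski1990, §3.3] -/
theorem congruent_of_forall_embedding_congruent_of_det (H H' : Matrix ι ι L)
    (hH : H.transpose.map (IsCMField.complexConj L) = H) (hH' : H'.transpose.map (IsCMField.complexConj L) = H')
    (h0 : H.det ≠ 0) (h0' : H'.det ≠ 0)
    (hloc : ∀ τ : L →+* ℂ, ∃ g : GL ι ℂ, (g : Matrix ι ι ℂ)ᴴ * H.map τ * (g : Matrix ι ι ℂ) = H'.map τ)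
    (hdet : ∃ z : L, z ≠ 0 ∧ H.det = H'.det * (z * IsCMField.complexConj L z)) :
    ∃ g : GL ι L, ((g : Matrix ι ι L).transpose.map (IsCMField.complexConj L)) * H * (g : Matrix ι ι L) = H' := by
  refine (hermitianMatrices_congruent_iff_invariants L H H' hH hH' h0 h0').2 ⟨fun τ => ?_, hdet⟩
  obtain ⟨g, hg⟩ := hloc τ
  exact Landherr.card_pos_eigenvalues_map_eq_of_congr_units L hH hH' τ g hg

/-- **Landherr's theorem, local-at-infinity form.**  Two non-degenerate `σ`-hermitian matrices `H, H'` over a CM field `L`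
are congruent over `L` (`H' = ᵗ(σg) · H · g`, `g ∈ GL(L)`) iff they are congruent over `ℂ` at every complex embedding
`τ : L →+* ℂ` (`τ(H') = gᴴ · τ(H) · g`, `g ∈ GL(ℂ)` — by Sylvester the same as equal signatures) and `det H = det H' · z σ(z)`
for some `z ∈ Lˣ`. [cite: Landherr1936HermitianForms] [cite: HornJohnson2013, Thm. 4.5.8] [cite: Rogawski1990, §3.3] -/
theorem hermitianMatrices_congruent_iff_forall_embedding_congruent (H H' : Matrix ι ι L)
    (hH : H.transpose.map (IsCMField.complexConj L) = H) (hH' : H'.transpose.map (IsCMField.complexConj L) = H')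
    (h0 : H.det ≠ 0) (h0' : H'.det ≠ 0) :
    (∃ g : GL ι L, ((g : Matrix ι ι L).transpose.map (IsCMField.complexConj L)) * H * (g : Matrix ι ι L) = H') ↔
      ((∀ τ : L →+* ℂ, ∃ g : GL ι ℂ, (g : Matrix ι ι ℂ)ᴴ * H.map τ * (g : Matrix ι ι ℂ) = H'.map τ) ∧
        ∃ z : L, z ≠ 0 ∧ H.det = H'.det * (z * IsCMField.complexConj L z)) := by
  refine ⟨fun h => ⟨forall_embedding_congruent_of_congruent L h, ?_⟩,
    fun h => congruent_of_forall_embedding_congruent_of_det L H H' hH hH' h0 h0' h.1 h.2⟩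
  exact ((hermitianMatrices_congruent_iff_invariants L H H' hH hH' h0 h0').1 h).2

end LocalGlobal

end Literature.NumberTheory.QuadraticForms

end
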